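import Summits.CriticalPhenomena.SAWScalingLimit.Theorems.ShellCrossingBound.Negative.Forcing6Shell

/-!
# `ShellCrossingBound` — negative knowledge (cycle 2, part 1/2): an INTERIOR endpoint approximation

Support file for crux `stmt-CriticalPhenomena-4728` (refuter `cdisprove`, cycle 2; work file
`Summits/CriticalPhenomena/SAWScalingLimit/Cruxes/ShellCrossingBound/Disproof.lean`). Everything is
proved (no `sorry`; axioms `propext, Classical.choice, Quot.sound`).

`SAW.IsEndpointApprox D a b` only asks that `a_δ, b_δ` be joined in `Ω_δ` for small `δ` and that
`δ·a_δ → a`, `δ·b_δ → b`; it does NOT ask the lattice endpoints to be boundary-adjacent. This file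
builds, in the explicit Dobrushin domain `Forcing.forcingDomain` of cycle 1 (the triangle
`(0, 1 ∓ i/4)` sheared along `ctr x = √x · sin (π/x)`), the endpoint approximation `(aδ, bInt)`
whose second point `bInt δ` converges to the marked corner `b = 1 − i/4` while staying at distance
`≍ √δ ≫ δ` from `∂Ω`: `closedBall (δ·bInt δ) (√δ/2) ⊆ Ω` (`closedBall_bInt_subset`),
`isEndpointApprox_int`. Ingredient: a `14`-Lipschitz bound for `ctr` on `[1/2, 1]`
(`abs_ctr_sub_ctr_le`). Part 2 (`BulkThresholdTwo.lean`) uses it to refute the fixed-threshold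
bulk Aizenman–Burchard statement for `k₀ ≤ 2`. [folklore]
-/

noncomputable section

open Set Filter Topology Metric MeasureTheory Complex
open scoped ENNReal Real unitInterval
open Literature.Probability.RandomPlanarGeometry Literature.Probability.LatticeModels

namespace Summit.CriticalPhenomena.SAWScalingLimit.Theorems.ShellCrossingBound.Negative

namespace Bulk

open Forcing

/-! ## 1. A Lipschitz bound for the centre line `ctr x = √x · sin (π/x)` on `[1/2, 1]` -/

/-- `|√x − √y| ≤ |x − y|` for `x, y ≥ 1/2`. [folklore] -/
theorem abs_sqrt_sub_sqrt_le {x y : ℝ} (hx : 1 / 2 ≤ x) (hy : 1 / 2 ≤ y) :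
    |Real.sqrt x - Real.sqrt y| ≤ |x - y| := by
  have hx0 : 0 ≤ x := by linarith
  have hy0 : 0 ≤ y := by linarith
  have hsx : Real.sqrt (1 / 2) ≤ Real.sqrt x := Real.sqrt_le_sqrt hx
  have hsy : Real.sqrt (1 / 2) ≤ Real.sqrt y := Real.sqrt_le_sqrt hy
  have hhalf : 1 / 2 ≤ Real.sqrt (1 / 2) := by
    rw [Real.le_sqrt (by norm_num) (by norm_num)]
    norm_num
  have hsum : 1 ≤ Real.sqrt x + Real.sqrt y := by linarith
  have hprod : (Real.sqrt x - Real.sqrt y) * (Real.sqrt x + Real.sqrt y) = x - y := by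
    have h1 := Real.mul_self_sqrt hx0
    have h2 := Real.mul_self_sqrt hy0
    nlinarith
  have habs : |Real.sqrt x - Real.sqrt y| * (Real.sqrt x + Real.sqrt y) = |x - y| := by
    rw [← hprod, abs_mul, abs_of_nonneg (by linarith : 0 ≤ Real.sqrt x + Real.sqrt y)]
  calc |Real.sqrt x - Real.sqrt y| ≤ |Real.sqrt x - Real.sqrt y| * (Real.sqrt x + Real.sqrt y) :=
        le_mul_of_one_le_right (abs_nonneg _) hsum
    _ = |x - y| := habs

/-- The centre line is `14`-Lipschitz on `[1/2, 1]`: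
`ctr x − ctr y = √x (sin(π/x) − sin(π/y)) + (√x − √y) sin(π/y)`. [folklore] -/
theorem abs_ctr_sub_ctr_le {x y : ℝ} (hx : 1 / 2 ≤ x) (hx1 : x ≤ 1) (hy : 1 / 2 ≤ y) :
    |ctr x - ctr y| ≤ 14 * |x - y| := by
  have hx0 : 0 < x := by linarith
  have hy0 : 0 < y := by linarith
  have hsx1 : Real.sqrt x ≤ 1 := Real.sqrt_le_one.mpr hx1 |>.trans_eq' rfl
  have hsx0 : 0 ≤ Real.sqrt x := Real.sqrt_nonneg _
  -- the two pieces
  have hA : |Real.sqrt x * (Real.sin (π / x) - Real.sin (π / y))| ≤ 13 * |x - y| := by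
    rw [abs_mul, abs_of_nonneg hsx0]
    have h1 : |Real.sin (π / x) - Real.sin (π / y)| ≤ |π / x - π / y| := Real.abs_sin_sub_sin_le _ _
    have h2 : π / x - π / y = π * ((y - x) / (x * y)) := by
      field_simp
    have h3 : |π / x - π / y| ≤ 13 * |x - y| := by
      rw [h2, abs_mul, abs_of_pos Real.pi_pos, abs_div, abs_of_pos (mul_pos hx0 hy0), abs_sub_comm]
      have hxy : 1 / 4 ≤ x * y := by nlinarith
      have h4 : |x - y| / (x * y) ≤ |x - y| / (1 / 4) :=
        div_le_div_of_nonneg_left (abs_nonneg _) (by norm_num) hxy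
      have h5 : π ≤ 3.25 := by linarith [Real.pi_lt_d2]
      calc π * (|x - y| / (x * y)) ≤ 3.25 * (|x - y| / (1 / 4)) :=
            mul_le_mul h5 h4 (by positivity) (by norm_num)
        _ = 13 * |x - y| := by ring
    calc Real.sqrt x * |Real.sin (π / x) - Real.sin (π / y)| ≤ 1 * (13 * |x - y|) :=
          mul_le_mul hsx1 (h1.trans h3) (abs_nonneg _) zero_le_one
      _ = 13 * |x - y| := one_mul _
  have hB : |(Real.sqrt x - Real.sqrt y) * Real.sin (π / y)| ≤ |x - y| := by
    rw [abs_mul]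
    calc |Real.sqrt x - Real.sqrt y| * |Real.sin (π / y)| ≤ |x - y| * 1 :=
          mul_le_mul (abs_sqrt_sub_sqrt_le hx hy) (Real.abs_sin_le_one _) (abs_nonneg _) (abs_nonneg _)
      _ = |x - y| := mul_one _
  have hsplit : ctr x - ctr y =
      Real.sqrt x * (Real.sin (π / x) - Real.sin (π / y)) + (Real.sqrt x - Real.sqrt y) * Real.sin (π / y) := by
    simp only [ctr]; ring
  rw [hsplit]
  exact (abs_add_le _ _).trans (by linarith)

/-! ## 2. The interior endpoint approximation `bInt` of the corner `b = 1 − i/4` -/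

/-- Column of the interior endpoint: abscissa `≈ 1 − 2√δ`. [folklore] -/
def iI (δ : ℝ) : ℤ := ⌊(1 - 2 * Real.sqrt δ) / δ⌋

/-- Level of the interior endpoint: `9√δ` above the lower boundary curve of its column. [folklore] -/
def jI (δ : ℝ) : ℤ := round ((ctr (δ * iI δ) - sl * (δ * iI δ) + 9 * Real.sqrt δ) / δ)

/-- `bInt δ`: an INTERIOR lattice approximation of the marked corner `b = 1 − i/4`, at distance
`≍ √δ ≫ δ` from `∂Ω` (allowed by `SAW.IsEndpointApprox`, which only asks `δ · b_δ → b`). [folklore] -/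
def bInt (δ : ℝ) : Site 2 := ![iI δ, jI δ]

section Endpoint

variable {δ : ℝ} (hδ : 0 < δ)
include hδ

/-- The abscissa of `bInt`. [folklore] -/
theorem iI_bounds : 1 - 2 * Real.sqrt δ - δ < δ * (iI δ : ℝ) ∧ δ * (iI δ : ℝ) ≤ 1 - 2 * Real.sqrt δ := by
  have h1 : ((iI δ : ℤ) : ℝ) ≤ (1 - 2 * Real.sqrt δ) / δ := Int.floor_le _
  have h2 : (1 - 2 * Real.sqrt δ) / δ < ((iI δ : ℤ) : ℝ) + 1 := Int.lt_floor_add_one _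
  have h1' : δ * ((iI δ : ℤ) : ℝ) ≤ δ * ((1 - 2 * Real.sqrt δ) / δ) := mul_le_mul_of_nonneg_left h1 hδ.le
  have h2' : δ * ((1 - 2 * Real.sqrt δ) / δ) < δ * (((iI δ : ℤ) : ℝ) + 1) := mul_lt_mul_of_pos_left h2 hδ
  rw [mul_div_cancel₀ _ hδ.ne'] at h1' h2'
  constructor <;> linarith

/-- The ordinate of `bInt` is within half a mesh of its target level. [folklore] -/
theorem jI_bounds :
    |δ * (jI δ : ℝ) - (ctr (δ * iI δ) - sl * (δ * iI δ) + 9 * Real.sqrt δ)| ≤ δ / 2 := by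
  set c : ℝ := ctr (δ * iI δ) - sl * (δ * iI δ) + 9 * Real.sqrt δ with hc
  have h := abs_sub_round (c / δ)
  have : δ * (jI δ : ℝ) - c = -(δ * (c / δ - round (c / δ))) := by
    rw [jI, ← hc]; field_simp; ring
  rw [this, abs_neg, abs_mul, abs_of_pos hδ]
  nlinarith

/-- Numerical smallness used throughout: for `δ ≤ 1/2500`, `√δ ≤ 1/50` and `δ ≤ √δ / 50`. [folklore] -/
theorem sqrt_small (h : δ ≤ 1 / 2500) : Real.sqrt δ ≤ 1 / 50 ∧ δ ≤ Real.sqrt δ / 50 ∧ 0 < Real.sqrt δ := by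
  have hs : Real.sqrt δ ≤ 1 / 50 := by
    rw [Real.sqrt_le_left (by norm_num)]
    norm_num; linarith
  have hpos : 0 < Real.sqrt δ := Real.sqrt_pos.2 hδ
  refine ⟨hs, ?_, hpos⟩
  have hsq : δ = Real.sqrt δ * Real.sqrt δ := (Real.mul_self_sqrt hδ.le).symm
  have : Real.sqrt δ * Real.sqrt δ ≤ Real.sqrt δ * (1 / 50) := mul_le_mul_of_nonneg_left hs hpos.le
  linarith

/-- The endpoint column lies in `[1/2, 1)` (indeed in `(1 − 3√δ, 1 − 2√δ]`). [folklore] -/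
theorem re_bounds (h : δ ≤ 1 / 2500) :
    1 - 3 * Real.sqrt δ < δ * (iI δ : ℝ) ∧ δ * (iI δ : ℝ) ≤ 1 - 2 * Real.sqrt δ ∧ 1 / 2 ≤ δ * (iI δ : ℝ) := by
  obtain ⟨h1, h2⟩ := iI_bounds hδ
  obtain ⟨hs, hds, -⟩ := sqrt_small hδ h
  refine ⟨by linarith, h2, by linarith⟩

/-- The ordinate of `δ · bInt δ` relative to the centre line: strictly inside the wedge, at height
between `8 √δ` and `10 √δ` above the lower boundary. [folklore] -/
theorem im_bounds (h : δ ≤ 1 / 2500) :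
    -(sl * (δ * iI δ)) + 8 * Real.sqrt δ ≤ δ * (jI δ : ℝ) - ctr (δ * iI δ) ∧
      δ * (jI δ : ℝ) - ctr (δ * iI δ) ≤ -(sl * (δ * iI δ)) + 10 * Real.sqrt δ := by
  have hj := jI_bounds hδ
  obtain ⟨hs, hds, -⟩ := sqrt_small hδ h
  rw [abs_le] at hj
  constructor <;> linarith [hj.1, hj.2]

/-- `bInt δ` is a mesh vertex of the witness domain. [folklore] -/
theorem bInt_mem (h : δ ≤ 1 / 2500) : bInt δ ∈ meshVertices forcingDomain.carrier δ := by
  obtain ⟨hr1, hr2, hr3⟩ := re_bounds hδ h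
  obtain ⟨hi1, hi2⟩ := im_bounds hδ h
  obtain ⟨hs, hds, hspos⟩ := sqrt_small hδ h
  simp only [bInt]
  rw [vec_mem_iff]
  refine ⟨?_, by linarith⟩
  rw [abs_lt]
  simp only [sl] at *
  constructor <;> nlinarith

/-- `bInt δ` lies in the resolved room `RS δ (xres δ)`. [folklore] -/
theorem bInt_mem_RS (h : δ ≤ 1 / 2500) : bInt δ ∈ RS δ (xres δ) := by
  refine ⟨bInt_mem hδ h, ?_⟩
  obtain ⟨-, -, hr3⟩ := re_bounds hδ h
  have := xres_le_quarter δ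
  simp only [bInt, Matrix.cons_val_zero]
  linarith

omit hδ in
/-- The mesh point of `bInt` in coordinates. [folklore] -/
theorem meshPoint_bInt : meshPoint δ (bInt δ) = ⟨δ * iI δ, δ * jI δ⟩ := by
  simp only [bInt]; exact meshPoint_vec δ _ _

/-- **The ball of radius `√δ / 2` about `δ · bInt δ` lies inside the domain** (the endpoint is
at distance `≫ δ` from the boundary). [folklore] -/
theorem closedBall_bInt_subset (h : δ ≤ 1 / 2500) :
    Metric.closedBall (meshPoint δ (bInt δ)) (Real.sqrt δ / 2) ⊆ forcingDomain.carrier := by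
  intro z hz
  rw [Metric.mem_closedBall, meshPoint_bInt] at hz
  obtain ⟨hr1, hr2, hr3⟩ := re_bounds hδ h
  obtain ⟨hi1, hi2⟩ := im_bounds hδ h
  obtain ⟨hs, hds, hspos⟩ := sqrt_small hδ h
  set q : ℂ := ⟨δ * iI δ, δ * jI δ⟩ with hq
  have hre : |z.re - δ * iI δ| ≤ Real.sqrt δ / 2 := by
    have := abs_re_le_norm (z - q)
    rw [Complex.dist_eq] at hz
    simpa [hq] using this.trans hz
  have him : |z.im - δ * jI δ| ≤ Real.sqrt δ / 2 := by
    have := abs_im_le_norm (z - q)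
    rw [Complex.dist_eq] at hz
    simpa [hq] using this.trans hz
  rw [abs_le] at hre him
  rw [carrier_eq_SW]
  refine ⟨?_, by linarith [hre.2]⟩
  -- the centre line moves by at most `14 · √δ/2 = 7 √δ` between the two abscissae
  have hzre1 : 1 / 2 ≤ z.re := by linarith [hre.1]
  have hzre2 : z.re ≤ 1 := by linarith [hre.2]
  have hq1 : δ * (iI δ : ℝ) ≤ 1 := by linarith
  have hctr : |ctr z.re - ctr (δ * iI δ)| ≤ 7 * Real.sqrt δ := by
    have := abs_ctr_sub_ctr_le hzre1 hzre2 hr3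
    have hd : |z.re - δ * iI δ| ≤ Real.sqrt δ / 2 := abs_le.2 hre
    linarith
  rw [abs_le] at hctr
  rw [abs_lt]
  simp only [sl] at *
  constructor <;> nlinarith [hctr.1, hctr.2, him.1, him.2, hre.1, hre.2]

/-- The two lattice endpoints are far apart: `δ · a_δ` has abscissa `< 1/4 + δ`, `δ · bInt δ` has
abscissa `≥ 1/2`. [folklore] -/
theorem dist_endpoints (hd0 : δ ≤ dmin 0) (h : δ ≤ 1 / 2500) :
    1 / 5 ≤ dist (meshPoint δ (aδ δ)) (meshPoint δ (bInt δ)) := by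
  obtain ⟨-, -, hr3⟩ := re_bounds hδ h
  obtain ⟨-, ha2⟩ := icol_bounds hδ
  have hx := xres_le_quarter δ
  have hsmall := delta_small hδ hd0
  have hre : (meshPoint δ (bInt δ)).re - (meshPoint δ (aδ δ)).re ≥ 1 / 5 := by
    rw [meshPoint_bInt]
    simp only [aδ, meshPoint_vec]
    show δ * (iI δ : ℝ) - δ * (icol δ : ℝ) ≥ 1 / 5
    linarith
  have := abs_re_le_norm (meshPoint δ (bInt δ) - meshPoint δ (aδ δ))
  rw [Complex.sub_re] at this
  rw [dist_comm, Complex.dist_eq]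
  exact le_trans (le_trans hre.le (le_abs_self _)) this

end Endpoint

/-- **`(a_δ, bInt δ)` is an endpoint approximation of the witness domain**: joined in `Ω_δ` for
small `δ` (both lie in the resolved room), `δ · a_δ → 0 = a` (cycle 1), and `δ · bInt δ → 1 − i/4 = b`
at speed `O(√δ)`. [folklore] -/
theorem isEndpointApprox_int : SAW.IsEndpointApprox forcingDomain aδ bInt := by
  have hpos : ∀ {d : ℝ}, 0 < d → Ioo (0 : ℝ) d ∈ 𝓝[>] (0 : ℝ) := fun hd => Ioo_mem_nhdsGT hd
  refine ⟨?_, isEndpointApprox.tendsto_fst, ?_⟩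
  · filter_upwards [hpos (lt_min (dmin_pos 0) (show (0 : ℝ) < 1 / 2500 by norm_num))] with δ hδ
    obtain ⟨hδ0, hδ1⟩ := hδ
    have hd0 : δ ≤ dmin 0 := (hδ1.trans_le (min_le_left _ _)).le
    have h25 : δ ≤ 1 / 2500 := (hδ1.trans_le (min_le_right _ _)).le
    exact reachable_dd (good_xres hδ0 hd0) (aδ_mem_RS hδ0 hd0) (bInt_mem_RS hδ0 h25)
  · rw [forcingDomain_pt_one, Metric.tendsto_nhds]
    intro ε hε
    have hε' : 0 < (ε / 60) ^ 2 := by positivity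
    filter_upwards [hpos (lt_min (show (0 : ℝ) < 1 / 2500 by norm_num) hε')] with δ hδ
    obtain ⟨hδ0, hδ1⟩ := hδ
    have h25 : δ ≤ 1 / 2500 := (hδ1.trans_le (min_le_left _ _)).le
    have hδε : δ < (ε / 60) ^ 2 := hδ1.trans_le (min_le_right _ _)
    have hsε : Real.sqrt δ < ε / 60 := by
      rw [Real.sqrt_lt' (by positivity)]
      exact hδε
    obtain ⟨hr1, hr2, hr3⟩ := re_bounds hδ0 h25
    obtain ⟨hi1, hi2⟩ := im_bounds hδ0 h25
    obtain ⟨hs, hds, hspos⟩ := sqrt_small hδ0 h25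
    have hq1 : δ * (iI δ : ℝ) ≤ 1 := by linarith
    have hctr : |ctr (δ * iI δ) - ctr 1| ≤ 14 * |δ * iI δ - 1| :=
      abs_ctr_sub_ctr_le hr3 hq1 (by norm_num)
    rw [ctr_one, sub_zero, abs_of_nonpos (by linarith : δ * (iI δ : ℝ) - 1 ≤ 0)] at hctr
    rw [abs_le] at hctr
    rw [meshPoint_bInt]
    refine lt_of_le_of_lt (dist_le_abs_re_add_abs_im _ _) ?_
    simp only [vB]
    have hA : |δ * (iI δ : ℝ) - 1| ≤ 3 * Real.sqrt δ := by
      rw [abs_of_nonpos (by linarith : δ * (iI δ : ℝ) - 1 ≤ 0)]; linarith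
    have hB : |δ * (jI δ : ℝ) - -sl| ≤ 56 * Real.sqrt δ := by
      rw [abs_le]
      simp only [sl] at *
      constructor <;> nlinarith [hctr.1, hctr.2]
    linarith

end Bulk

end Summit.CriticalPhenomena.SAWScalingLimit.Theorems.ShellCrossingBound.Negative

end
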